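import Mathlib
import Summits.Ventures.PercRepro2.Defs
import Summits.Ventures.PercRepro2.Independence
import Summits.Ventures.PercRepro2.Harris
import Summits.Ventures.PercRepro2.Graph
import Summits.Ventures.PercRepro2.Exploration
import Summits.Ventures.PercRepro2.Events
import Summits.Ventures.PercRepro2.Statements
import Summits.Ventures.PercRepro2.FourFunctions
import Summits.Ventures.PercRepro2.Induced
import Summits.Ventures.PercRepro2.Frontier
import Summits.Ventures.PercRepro2.ObsIndependence
import Summits.Ventures.PercRepro2.BHK
import Summits.Ventures.PercRepro2.BHKEvents
import Summits.Ventures.PercRepro2.OrderPreservation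
import Summits.Ventures.PercRepro2.KNTwo
import Summits.Ventures.PercRepro2.KNArgmin

/-!
# R2′ at `|A| = 3`: what closes (blind cell PercRepro2, p1; T2 target, partial)

R2′: for `A = {a*, a₂, a₃}` with `P(a* ↔ b) ≤ P(a_i ↔ b)` (`a*` the `b`-distance minimiser),
`P(v ↔ A, a* ↔ b) ≤ P(v ↔ A, v ↔ b)`. Open in general (0/51,938 violations at `n = 6`, p1 census;
lead: 0/120,978). Proved here:

* `r2prime_reduction`: R2′ is equivalent to the two-cluster inequality
  `P(v ↔ T, v ↮ b, a* ↔ b) ≤ P(v ↔ T, v ↔ b, a* ↮ b)` with `T = {a₂, a₃}` — the parts of both sides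
  with `a* ↔ v` or with `v ↔ b, a* ↔ b` coincide (exact, any `T`);
* `r2prime_pair_part`: the part of the hit set `{a₂, a₃}` (both in `C(v)`) satisfies
  `P(v ↔ a₂, v ↔ a₃, a* ↔ b) ≤ P(v ↔ a₂, v ↔ a₃, v ↔ b)` — R10 at the root `a₂` with the up-set
  `{W | v ∈ W ∧ a₃ ∈ W}`;
* `r2prime_root_part`: for each `i`, `P(v ↔ a_i, a* ↔ b) ≤ P(v ↔ a_i, v ↔ b)` (R10 at the root `a_i`),
  i.e. the hit sets `{a_i}` and `{a₂, a₃}` together are fine for each `i` — the remaining obstruction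
  is that the two singleton parts may both be negative (p1 census: 2,196/51,938 instances at `n = 6`).
-/

namespace Summit.Ventures.PercRepro2

section R2Prime

variable {V : Type*} {E : Type*} [Fintype E] [DecidableEq E] [Fintype V] [DecidableEq V]
  {R : Type*} [Field R] [LinearOrder R] [IsStrictOrderedRing R]

/-- **Pair part of R2′**: R10 at the root `a₂` with the up-set `{W | v ∈ W ∧ a₃ ∈ W}`. -/
theorem r2prime_pair_part (p : E → R) (hp : IsProbVec p) (ends : E → Sym2 V) (v a₂ a₃ a b : V)
    (h : prob p (connEvent ends a b) ≤ prob p (connEvent ends a₂ b)) :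
    prob p (connEvent ends v a₂ ∩ connEvent ends v a₃ ∩ connEvent ends a b) ≤
      prob p (connEvent ends v a₂ ∩ connEvent ends v a₃ ∩ connEvent ends v b) := by
  have hU : IsUpperSet {W : Set V | v ∈ W ∧ a₃ ∈ W} := fun _ _ hWW h => ⟨hWW h.1, hWW h.2⟩
  have hR := orderPreserving_conn p hp ends a₂ a b hU h
  have e1 : clusterInEvent ends a₂ {W : Set V | v ∈ W ∧ a₃ ∈ W} =
      connEvent ends v a₂ ∩ connEvent ends v a₃ := by
    ext ω
    simp only [mem_clusterInEvent, Set.mem_setOf_eq, mem_cluster, Set.mem_inter_iff, mem_connEvent]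
    constructor
    · rintro ⟨h1, h2⟩
      exact ⟨conn_symm h1, conn_trans (conn_symm h1) h2⟩
    · rintro ⟨h1, h2⟩
      exact ⟨conn_symm h1, conn_trans (conn_symm h1) h2⟩
  have e2 : connEvent ends v a₂ ∩ connEvent ends v a₃ ∩ connEvent ends a₂ b =
      connEvent ends v a₂ ∩ connEvent ends v a₃ ∩ connEvent ends v b := by
    ext ω
    simp only [Set.mem_inter_iff, mem_connEvent]
    constructor
    · rintro ⟨⟨h1, h2⟩, h3⟩
      exact ⟨⟨h1, h2⟩, conn_trans h1 h3⟩
    · rintro ⟨⟨h1, h2⟩, h3⟩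
      exact ⟨⟨h1, h2⟩, conn_trans (conn_symm h1) h3⟩
  rw [e1, e2] at hR
  exact hR

/-- **Root part of R2′**: R10 at the root `a_i`, `P(v ↔ a_i, a ↔ b) ≤ P(v ↔ a_i, v ↔ b)`
(the hit sets `{a_i}` and `{a₂, a₃}` together). -/
theorem r2prime_root_part (p : E → R) (hp : IsProbVec p) (ends : E → Sym2 V) (v aᵢ a b : V)
    (h : prob p (connEvent ends a b) ≤ prob p (connEvent ends aᵢ b)) :
    prob p (connEvent ends v aᵢ ∩ connEvent ends a b) ≤
      prob p (connEvent ends v aᵢ ∩ connEvent ends v b) := by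
  have hR := orderPreserving_conn p hp ends aᵢ a b (isUpperSet_mem_setOf v) h
  rw [clusterInEvent_mem_eq_connEvent] at hR
  have e : connEvent ends v aᵢ ∩ connEvent ends aᵢ b = connEvent ends v aᵢ ∩ connEvent ends v b := by
    ext ω
    simp only [Set.mem_inter_iff, mem_connEvent]
    constructor
    · rintro ⟨h1, h2⟩
      exact ⟨h1, conn_trans h1 h2⟩
    · rintro ⟨h1, h2⟩
      exact ⟨h1, conn_trans (conn_symm h1) h2⟩
  rw [e] at hR
  exact hR

omit [Fintype V] [DecidableEq V] [LinearOrder R] [IsStrictOrderedRing R] in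
/-- **Reduction of R2′** to the two-cluster form: for any event `H` (the hitting event) and
vertices `v, a, b`,
`P(H ∩ {v ↔ b}) − P(H ∩ {a ↔ b}) = P(H, v ↔ b, a ↮ b) − P(H, v ↮ b, a ↔ b)`. -/
theorem r2prime_reduction (p : E → R) (ends : E → Sym2 V) (H : Set (Config E)) (v a b : V) :
    prob p (H ∩ connEvent ends v b) - prob p (H ∩ connEvent ends a b) =
      prob p (H ∩ connEvent ends v b ∩ (connEvent ends a b)ᶜ) -
        prob p (H ∩ (connEvent ends v b)ᶜ ∩ connEvent ends a b) := by
  have h1 := prob_inter_add_prob_inter_compl p (H ∩ connEvent ends v b) (connEvent ends a b)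
  have h2 := prob_inter_add_prob_inter_compl p (H ∩ connEvent ends a b) (connEvent ends v b)
  have e : H ∩ connEvent ends a b ∩ connEvent ends v b = H ∩ connEvent ends v b ∩ connEvent ends a b := by
    ext ω; simp only [Set.mem_inter_iff]; tauto
  have e' : H ∩ connEvent ends a b ∩ (connEvent ends v b)ᶜ =
      H ∩ (connEvent ends v b)ᶜ ∩ connEvent ends a b := by
    ext ω; simp only [Set.mem_inter_iff]; tauto
  rw [e, e'] at h2
  linear_combination h2 - h1

end R2Prime

end Summit.Ventures.PercRepro2
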